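import Summits.AtomisticToContinuum.FouriersLaw.Theorems.BondHeatUncertaintyExtensiveSnapshotIrreversibilityEnergyWindowSkeletonSurjectivity
import Summits.AtomisticToContinuum.FouriersLaw.Theorems.BondHeatUncertaintyExtensiveSnapshotIrreversibilityEnergyWindowCostateAt

/-!
# Energy window, part W-7b — PROOF of the leaf (I-s2)ₛ `SkeletonEventualSurjectivity`

Lineage `stmt-AtomisticToContinuum-9121` (`ExtensiveSnapshotIrreversibility`), K_fix half, leaf S3;
cell decomp-a2c, lens «grading / quantitative ladder», generation 81, part W «Glues», file 7b.
Imports W-0 (`…EnergyWindowSkeletonSurjectivity`: the leaf `SkeletonEventualSurjectivity`, whose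
transitive imports contain part S `…SkeletonRefinement` with the time-`s` refinement identity
`fderiv_skelFlowMapAt_refinePair`) and W-7a (`…EnergyWindowCostateAt`: costate calculus on `[0, t]`).

THE THEOREM (`skeletonEventualSurjectivity : SkeletonEventualSurjectivity`, §2).  For the pinned
anharmonic chain (`ω₂ > 0`, `lam, β ≥ 0`, `γ > 0`, `N ≥ 1`, `T_L > 0`), every time `0 < s ≤ 1`, every
start `z` and EVERY two-sided driving path `wp`, the derivative of the time-`s` skeleton flow map
`x ↦ E^{s}_m(z, R_m wp, x)` at the path's own skeleton `Ξ_m wp` is onto phase space for all large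
levels `m`.  PROOF = the tree's `s = 1` argument (`exists_forall_range_fderiv_skelFlowMap_eq_top`,
CEHR Prop. 4.1 in skeleton form) run on the window `[0, s]`:
* §1 the ranges increase with `m` (`range_fderiv_skelFlowMapAt_mono`, from part S
  `fderiv_skelFlowMapAt_refinePair`), so as an increasing sequence of subspaces of the
  finite-dimensional phase space (`rangeSeqAt`) they are eventually constant (Noetherian);
* §2 if the stable range were proper it would miss a costate direction `c₁ ≠ 0`
  (`exists_dualPair_eq_zero_of_ne_top`); the costate `c` along the Brownian trajectory with
  `c(s) = c₁` (`exists_linearODE_solution_of_continuous`, started at time `s`) pairs to zero with the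
  time-`s` variational endpoints of all skeleton directions (`fderiv_skelFlowMapAt_apply`), in
  particular with those of the left-bath dyadic tent forcings whose cell `[k/2^m, (k+1)/2^m]` lies in
  `[0, s]`; by W-7a `dualPair_costate_at_tent` the mean of the left-bath momentum component of `c` over
  every such cell vanishes, so `c(s) = 0` by W-7a `costate_at_eq_zero_of_dyadic` — contradiction.
The only differences from the tree proof: the costate is started at time `s`, only the dyadic cells
inside `[0, s]` are used (their index satisfies `k < 2^m` because `s ≤ 1`), and the density step is
W-7a's interior-positivity lemma.  Hypotheses as in the tree theorem (`0 ≤ lam`, `0 ≤ β` suffice; `T_R`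
free); the leaf quantifies `0 < lam`, `0 < β`, `0 < T_R`, which are weakened.
CONSEQUENCE (W-7c `…EnergyWindowWeightsGlue`): the hypothesis `(hI : SkeletonEventualSurjectivity)` of
the U-glue (W-3), the V-glue (W-6) and the junctions (W-6 §7) is discharged; the record becomes
S3 ⟸ (Dˢ) ∧ (SWM).  No instance / notation / option; no proof holes.
References: the tree files above; [cite: CuneoEckmannHairerReyBellet2018, Prop 4.1];
(after Nualart2006, §2.3). [folklore]
-/

noncomputable section

namespace Summit.AtomisticToContinuum.FouriersLaw.Theorems.ExtensiveSnapshotIrreversibility.EnergyWindow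

open MeasureTheory Filter Topology Set
open scoped ContDiff
open Literature.MathematicalPhysics.KineticTheory.HeatConduction
open Literature.Probability.Process Literature.Analysis.ODE

section Surj

variable {ω₂ lam β γ : ℝ} (hω : 0 < ω₂) (hl : 0 ≤ lam) (hβ : 0 ≤ β) (hγ : 0 ≤ γ) (N : ℕ)
  (T_L T_R : ℝ)

include hω hl hβ hγ

/-! ## 1. The ranges of the time-`s` skeleton derivatives increase with the level -/

/-- **The ranges increase with the level** at every time `s ∈ [0, 1]`: a level-`m` direction refines
to a level-`m+1` direction with the same time-`s` variational endpoint (part S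
`fderiv_skelFlowMapAt_refinePair`); the tree's `range_fderiv_skelFlowMap_mono` is `s = 1`. [folklore] -/
theorem range_fderiv_skelFlowMapAt_mono {s : ℝ} (hs : s ∈ Icc (0 : ℝ) 1) (z : PhaseSpace N)
    (wp : WienerPair) (m : ℕ) :
    LinearMap.range (fderiv ℝ (skelFlowMapAt ω₂ lam β γ N T_L T_R s m z (pairRem m wp))
        (pairSkel m wp) : PairSkeleton m →ₗ[ℝ] PhaseSpace N) ≤
      LinearMap.range (fderiv ℝ (skelFlowMapAt ω₂ lam β γ N T_L T_R s (m + 1) z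
        (pairRem (m + 1) wp)) (pairSkel (m + 1) wp) : PairSkeleton (m + 1) →ₗ[ℝ] PhaseSpace N) := by
  rintro v ⟨δ, rfl⟩
  refine ⟨refinePair m δ, ?_⟩
  change fderiv ℝ (skelFlowMapAt ω₂ lam β γ N T_L T_R s (m + 1) z (pairRem (m + 1) wp))
      (pairSkel (m + 1) wp) (refinePair m δ) =
    fderiv ℝ (skelFlowMapAt ω₂ lam β γ N T_L T_R s m z (pairRem m wp)) (pairSkel m wp) δ
  exact fderiv_skelFlowMapAt_refinePair hω hl hβ hγ N T_L T_R hs m z wp δ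

/-- The time-`s` ranges, as an increasing sequence of subspaces of phase space (tree `rangeSeq` is
`s = 1`). [folklore] -/
def rangeSeqAt {s : ℝ} (hs : s ∈ Icc (0 : ℝ) 1) (z : PhaseSpace N) (wp : WienerPair) :
    ℕ →o Submodule ℝ (PhaseSpace N) where
  toFun m := LinearMap.range (fderiv ℝ (skelFlowMapAt ω₂ lam β γ N T_L T_R s m z (pairRem m wp))
    (pairSkel m wp) : PairSkeleton m →ₗ[ℝ] PhaseSpace N)
  monotone' := monotone_nat_of_le_succ
    (range_fderiv_skelFlowMapAt_mono hω hl hβ hγ N T_L T_R hs z wp)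

/-! ## 2. Surjectivity for large levels, at every time `0 < s ≤ 1` -/

/-- **The time-`s` skeleton derivative at the path's own skeleton is onto for all large levels**
(`0 < s ≤ 1`; `γ T_L > 0`: the left bath is on; `N ≥ 1`).  Otherwise the (eventually constant) ranges
miss a costate direction `c₁ ≠ 0`; the costate `c` with `c(s) = c₁` pairs to zero with every time-`s`
variational endpoint, in particular with those of the left-bath tent forcings on the dyadic cells inside
`[0, s]`, so the dyadic means of its left-bath momentum component vanish there (W-7a
`dualPair_costate_at_tent`) and `c(s) = 0` (W-7a `costate_at_eq_zero_of_dyadic`), a contradiction.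
The tree's `exists_forall_range_fderiv_skelFlowMap_eq_top` is `s = 1`.
[cite: CuneoEckmannHairerReyBellet2018, Prop 4.1] -/
theorem exists_forall_range_fderiv_skelFlowMapAt_eq_top (hγ' : 0 < γ) (hL : 0 < T_L) (hN : 0 < N)
    {s : ℝ} (hs0 : 0 < s) (hs1 : s ≤ 1) (z : PhaseSpace N) (wp : WienerPair) :
    ∃ m₀ : ℕ, ∀ m, m₀ ≤ m →
      LinearMap.range (fderiv ℝ (skelFlowMapAt ω₂ lam β γ N T_L T_R s m z (pairRem m wp))
        (pairSkel m wp) : PairSkeleton m →ₗ[ℝ] PhaseSpace N) = ⊤ := by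
  have hs : s ∈ Icc (0 : ℝ) 1 := ⟨hs0.le, hs1⟩
  set P := pinnedChain ω₂ lam β γ with hP
  set f := rangeSeqAt hω hl hβ hγ N T_L T_R hs z wp with hf
  obtain ⟨m₀, hm₀⟩ := monotone_stabilizes_iff_noetherian.2 inferInstance f
  have hfm : ∀ m, (f m : Submodule ℝ (PhaseSpace N)) =
      LinearMap.range (fderiv ℝ (skelFlowMapAt ω₂ lam β γ N T_L T_R s m z (pairRem m wp))
        (pairSkel m wp) : PairSkeleton m →ₗ[ℝ] PhaseSpace N) := fun m => rfl
  suffices htop : f m₀ = ⊤ by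
    refine ⟨m₀, fun m hm => ?_⟩
    rw [← hfm, ← hm₀ m hm, htop]
  by_contra hne
  obtain ⟨c₁, hc₁, hann⟩ := exists_dualPair_eq_zero_of_ne_top hne
  have hall : ∀ m, ∀ v ∈ f m, dualPair c₁ v = 0 := fun m v hv =>
    hann v (by rw [hm₀ (max m m₀) (le_max_right _ _)]; exact f.monotone (le_max_left _ _) hv)
  -- the Brownian trajectory and its costate started at time `s`
  set ζ : ℝ → PhaseSpace N := fun u => P.solMap N T_L T_R u z (pairPath wp) with hζ
  have hζc : Continuous ζ := pinnedChain_continuous_solMap hω hl hβ hγ N T_L T_R z (pairPath wp)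
  obtain ⟨c, hc1, hcd⟩ := exists_linearODE_solution_of_continuous
    (fun u => coDriftLinear ω₂ lam β γ N (ζ u))
    (continuous_coDriftLinear_solMap hω hl hβ hγ N T_L T_R z wp) s c₁
  have hcc : ContinuousOn c (Icc 0 s) :=
    (continuous_iff_continuousAt.2 fun u => (hcd u).continuousAt).continuousOn
  have hcd' : ∀ u ∈ Ioo (0 : ℝ) s, HasDerivAt c (P.coDrift N (ζ u) (c u)) u := fun u _ => hcd u
  -- vanishing dyadic means of the left-bath momentum component on the cells inside `[0, s]`
  have hcL : ampL ω₂ lam β γ T_L ≠ 0 := by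
    unfold ampL
    have : (pinnedChain ω₂ lam β γ).γ = γ := rfl
    rw [this]
    positivity
  have hmeans : ∀ m k : ℕ, rnode m (k + 1) ≤ s →
      ∫ u in rnode m k..rnode m (k + 1), (c u).2 ⟨0, hN⟩ = 0 := by
    intro m k hks
    have hk : k < 2 ^ m := by
      have h2 : (0 : ℝ) < 2 ^ m := by positivity
      have h1 : ((k + 1 : ℕ) : ℝ) / 2 ^ m ≤ 1 := hks.trans hs1
      rw [div_le_one h2] at h1
      have h3 : k + 1 ≤ 2 ^ m := by exact_mod_cast h1
      omega
    set kk : Fin (2 ^ m) := ⟨k, hk⟩ with hkk'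
    have hkk : (kk : ℕ) = k := rfl
    set δ : PairSkeleton m := (Pi.single kk 1, 0) with hδ
    set W := pinnedChainVariation hω hl hβ hγ N z
      (continuous_chainNoise_rem ω₂ lam β γ N T_L T_R (pairRem m wp))
      (skelForcing N m (ampL ω₂ lam β γ T_L) (ampR ω₂ lam β γ T_R)) (pairSkel m wp) δ with hW
    have hW1 : dualPair c₁ (W s) = 0 := by
      refine hall m _ ⟨δ, ?_⟩
      exact fderiv_skelFlowMapAt_apply hω hl hβ hγ N T_L T_R hs m z (pairRem m wp) (pairSkel m wp) δ
    have hWeq : ∀ τ ∈ Icc (0 : ℝ) s, W τ = ((0 : Fin N → ℝ), fun i : Fin N =>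
        if i = ⟨0, hN⟩ then ampL ω₂ lam β γ T_L * rtent m k τ else 0) +
        ∫ u in (0 : ℝ)..τ, fderiv ℝ (P.drift N) (ζ u) (W u) := by
      intro τ hτ
      have hτ' : τ ∈ Icc (0 : ℝ) 1 := ⟨hτ.1, hτ.2.trans hs1⟩
      rw [hW, pinnedChainVariation_eq_solMap hω hl hβ hγ N T_L T_R m z wp δ hτ']
      congr 2
      funext i
      rw [skelForcing_single_fst, tentCoeff_toNN]
      by_cases hi : i = ⟨0, hN⟩
      · subst hi; simp [hkk]
      · have : i.val ≠ 0 := fun h => hi (Fin.ext h)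
        simp [hi, this]
    have htent := dualPair_costate_at_tent (pinnedChain_contDiff_U ω₂ lam β γ)
      (pinnedChain_contDiff_V ω₂ lam β γ) hζc
      (continuous_pinnedChainVariation hω hl hβ hγ N z _ _ (pairSkel m wp) δ) hcc hcd' ⟨0, hN⟩
      (ampL ω₂ lam β γ T_L) hks hWeq
    rw [hc1, hW1] at htent
    have h2 : (ampL ω₂ lam β γ T_L * 2 ^ m : ℝ) ≠ 0 := mul_ne_zero hcL (by positivity)
    rcases mul_eq_zero.1 htent.symm with h | h
    · exact absurd h h2
    · exact h
  have hc10 := costate_at_eq_zero_of_dyadic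
    (pinnedChain_deriv_deriv_V_ne_zero (ω₂ := ω₂) (lam := lam) (γ := γ) hβ) hN hs0 hcc hcd' hmeans
  rw [hc1] at hc10
  exact hc₁ hc10

end Surj

/-- **(I-s2)ₛ PROVED.** The leaf `SkeletonEventualSurjectivity` of W-0 holds (§2 with the leaf's
hypotheses `0 < lam`, `0 < β`, `0 < T_R` weakened / unused). [folklore] -/
theorem skeletonEventualSurjectivity : SkeletonEventualSurjectivity :=
  fun _ω₂ _lam _β _γ hω hl hβ hγ N hN T_L T_R hTL _hTR _s hs0 hs1 z wp =>
    exists_forall_range_fderiv_skelFlowMapAt_eq_top hω hl.le hβ.le hγ.le N T_L T_R hγ hTL hN hs0 hs1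
      z wp

end Summit.AtomisticToContinuum.FouriersLaw.Theorems.ExtensiveSnapshotIrreversibility.EnergyWindow

end
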